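import Summits.QuantumAdvantage.QuantumAdvantage.Theorems.BlindDialC

/-! # CounterDialA — part 1/2 of the landing twins of NODE «CounterDial» (decomp-qadv lens-2, generation 21)

Mechanical split for landing (content of the node file `pub/decomp-qadv/decomp-qadv-lens-2/g21/CounterDial.lean`
verbatim, under the `Theorems.CounterDial` namespace; the node elaborates under `Theses.CounterDial`).  This part:
§1–§3 the DARK-WINDOW LAW (`dark_orbit_loses`, `dark_loss_count`) and §4 its application — every GAPPED window-counter
family loses (`gappedCounterLoss3`), every PUNCHED one (`punchedCounterLoss3`).  The five `wStrat` helper lemmas the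
node vendored from lens-2 g20 are cited from the tree (`Theorems.BlindDial.loddG_apply` …) instead of restated.
Part 2 (`CounterDialB`): the dial, `closes` onto `Theses.SparsityDial.DenseGenericLoss3`, the certificates, the cube
exemplar.  The node's docstring follows verbatim. -/

/-!
# NODE «CounterDial» (decomp-qadv lens-2 «structural dichotomy: special vs generic», generation 21; RESIDUAL MODE on
`Theses.SparsityDial.DenseGenericLoss3` = D, stmt-QuantumAdvantage-27656 of DRAFT route-QuantumAdvantage-SparsityDial)

**Target (verbatim, BY NAME):** `Summit.QuantumAdvantage.QuantumAdvantage.Theses.SparsityDial.DenseGenericLoss3` (D).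
**Node:** `D ⟸ CounterLoss3 ∧ NonCounterGenericLoss3` (`closes`, by cases on the dial predicate; `dense_iff_split :
D ↔ A ∧ B`).  A **GENUINE SPLIT** — neither piece is proved here and neither is known to give D: A carries the tree's
named undecided rung `FullPaleyCounterLoss3` (`fullPaley_of_counterLoss`), B carries the fields with a genuine `AND`
bottom layer (§7) — NOT a law node (contrast g19 «ResponseDial», g20 «BlindDial»: law proved ⇒ residual ≡ D).

## The dial (new in the lineage V1–V22 and on the bus): COUNTER FORM = level sets of `Z₃`-LINEAR forms
A deviation field (`AnchorDial.dev P x` = the positions where the strategy leaves the canonical guess) is in **COUNTER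
FORM** (`CounterForm a A Q`) when, at every odd input, `k ∈ dev Q x ↔ Σ_i a_{k,i} x_i ∈ A_k` in `Z₃` — every deviation
gate is a `MOD₃` gate applied DIRECTLY to the input bits (bottom fan-in 1).  `StabCounter e P`: some pad of `P` by
stabilizer rows selected by polynomials of degree `≤ (log N)^e` (the gauge of `StabFew`, same format) is in counter
form.  Special piece **A = `CounterLoss3`**: D restricted to `StabCounter (c+1) P`; residual **B = `NonCounterGenericLoss3`**:
D restricted to `¬ StabCounter (c+1) P`.  EVERY dense family filed on this residual so far is counter-form at the zero
gauge: the antipodal family (`apStrat_stabCounter`), the half-cycle / interval / Paley / full-Paley / arbitrary WINDOW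
COUNTERS `wStrat W` (`wStrat_stabCounter`; first half-cycle = antipodal pointer `[x_{k+N/2} = 1]`, second = `[Σ_{i∈W_k}
x_i ≡ 0]`).  So A ALONE decides every window-counter rung (`windowCounterLoss3_of_counterLoss`), in particular the
lineage's first UNDECIDED named instance `FullPaleyCounterLoss3 := WindowCounterLoss3 fullPaleyW` (g20 §7; here §6).
The axis is SKEW to g19's additive-response dial: half-cycle counters are counter-form but not additive (tree
`ResponseDial.hcStrat_not_addResp`), and a reader of the 3-cell parity `x₁ ⊕ x₂ ⊕ x₃` responds additively but is not
counter-form (finite check on the 6-cell odd slice, 17496 coefficient/residue cases, scratch; not in this file).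

## Why the cut is principled (placement against print, `Literature.Barriers.QuantumAdvantage.TwoModuliDepthTwo`)
For ANY strategy the win indicator on the odd class is the parity `#{k ∈ dev P x : c_k(x) ≢ 2 (3)} mod 2`
(`AnchorDial.win_iff`), and the kernel forms `c_k = cN x k` are `Z₃`-linear in the PREFIX-PARITY bits `u` (the walk
coordinates; `x ↦ u` is `𝔽₂`-affine).  For a counter-form field the deviation gates are `MOD₃` gates of the bits `x`:
the win indicator is a `MOD₂ ∘ MOD₃` device with LINEAR bottom over the two coordinate systems `x, u` — the side of
the Constant-Degree-Hypothesis boundary where print has exponential-sum technology (`AND` is not a level set of a linear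
form: [BarringtonStraubingTherien1990, Thm 7]; `MOD_q ∘ MOD_m` size bounds [KrausePudlak1997] [GrolmuszTardos2000]; the
tree file proves the `d = 1` case).  A field outside counter form needs a genuine `AND` layer under its `MOD₃` gates —
the cube family of §7 reads `x₁ ∧ x₂ ∧ x₃` —, the regime the same barrier file records as "open in its general form for
over 30 years" [KawalekWeiss2023].  The dial therefore separates D along the printed solved/open line of its own method
family; it does not claim that either side is easy.

## ★ The engine proved here: THE DARK-WINDOW LAW (§1–§3; degree-free, certificate-free, gap-free)
`dark_orbit_loses`: let `b + 5 ≤ N`; the eight points `x^ε` (`ε ∈ 𝔽₂³`) flip the ADJACENT pairs `{b,b+1}, {b+1,b+2},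
{b+2,b+3}` selected by `ε` (overlapping flips, four cells).  If `x` is odd and the deviation set `S = dev P x^ε` is the
same at all eight points (the window is DARK for `P` at `x`), then `P` loses at one of them.  Proof: `c_k(x^ε) ≡ c_k(x) +
shW ε z β(k)` with `β(k) = min(k−b, 3)` the BAND of `k` and `z_i = zpar x (b+i+1)` (`cN_dw`, from the tree's `cN_orbL`);
per band the three shifted kernel counts `f_β(r) = #{k ∈ S ∩ band β : c_k + r ≢ 2}` satisfy `f_β(0)+f_β(1)+f_β(2) =
2·#(S ∩ band β)` (tree `three_counts`), so their parities form an even-weight TYPE (`type_lemma`); all-win means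
`Σ_β f_β(shW ε z β)` odd for all eight `ε`; the finite core `core` (`decide`, 2¹¹ type/parity patterns × 8 shifts) says
some `ε` gives an even total.  Counting: `dark_loss_count : #{odd, dark at b} ≤ 8·#{odd losers}` (tree
`card_filter_orbF`).  Brute force behind the design (scratch, x-coordinates with the tree formulas): 3 sites / 4 cells is
minimal — with 2 adjacent sites (3 cells) 11 of 32 orbits at N = 8 are all-win; with 3 sites none at N = 8, 9, 10.
RELATION to the lineage's laws: g14 `AnchorDial.frozen_orbit_loses` = 2 FAR sites + the ONE-GAP hypothesis (deviation set
inside one gap); g19 `ResponseDial.additive_orbit_loses` = 5 SEPARATED sites + 32 𝔽₂-certificates + additive response;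
g20 `blind_loss` = a same-parity pair move + pinned cells + blindness.  Here: 3 ADJACENT sites, no gap / response /
blindness / degree hypothesis beyond darkness of ONE 4-cell window, no certificate table (the core quantifies over types).

## What the law decides (§4, sub-rungs of A; 0 sorry, std axioms)
`gappedCounterLoss3`: every window system with an eventual GAP (four consecutive first-half-cycle cells `b…b+3`,
`b+4 ≤ n/2`, read by no counter) satisfies `WindowCounterLoss3 W` (`C = 1`, `n₀ = max n₁ 8`, `#odd ≤ 8·#losers` via the
tree's `real_loss_of_frac`).  `punchedCounterLoss3`: for EVERY window system `W`, the system `punch W` (cells `8…11`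
deleted from every window) is decided — every window-counter rung, FullPaley included (`punchedFullPaleyCounterLoss3`),
is FOUR CELLS away from a theorem; the undecided content of `FullPaleyCounterLoss3` is exactly that full-Paley windows
have no dark 4-window (every cell is read by about half the counters).

## Pieces (NODE OUTPUT CONTRACT; probes in `bc/Probe.lean`, verdicts in `bc/VERDICTS.txt`)
* **A · `CounterLoss3` · special · WEAKER · OPEN · ATTACKABLE.**  Why strictly weaker: a restriction of D (`counter_of_dense
  : D → A`); `A → D` is not known (probe must-fail) and would need B.  Why open: `A → FullPaleyCounterLoss3` (TREE N101 /
  critic 69v51: undecided, outside the orbit-certificate method).  Attackable: decided sub-rungs = all gapped systems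
  (this file), all odd-cell systems (g20's blind law, tree `ResponseDial.PaleyCounterLoss3` family), antipodal /
  half-cycle / interval counters (g18/g19); the gapless core is a two-moduli exponential sum with LINEAR bottom (above) —
  named tools: Weil-type bounds for the Paley coefficients, the `MOD_q∘MOD_m` exponential-sum method; UNDECIDED(test:
  exact win counts of `wStrat (fullPaleyW n)` on the odd class for `n = 12…26` by enumeration — does the loss fraction
  stay `≥ 1/n`? kit not allowed in this seat; g20's sampler saw loss ≈ 1/2 for odd-cell Paley at `n ≤ 100`).
* **B · `NonCounterGenericLoss3` · residual · WEAKER · OPEN · IDEA-NEEDED (barrier-adjacent).**  Why strictly weaker: a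
  restriction of D (`nonCounter_of_dense`); `B → D` needs A, which is open (probe must-fail) — so B is NOT `≡ D` modulo
  anything proved (contrast g19/g20).  Inhabitant: the CUBE family `cubeStrat` (§7: antipodal first half-cycle, so
  certified dense by the tree's `not_polylogSparse_of_agree` — `cube_in_dense_class`; every other position toggled by
  `x₁ ∧ x₂ ∧ x₃`, degree 5) is NOT counter-form at the zero gauge for `N ≥ 6` (`cube_not_counterForm_zero`, from the
  finite core `cube_core`: on the odd slice of the cells `0…4` no `Z₃`-linear form with any residue set cuts out the
  conjunction; `decide`, 5832 × 32 cases); `¬ StabCounter (c+1) cubeStrat` under NON-zero cheap gauges is UNDECIDED(test: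
  for `n ≤ 12` enumerate the gauge orbit `dev ⊕ M(x)β(x)` of the cube field over all selector families `β` of support
  `≤ 2` cells and check counter form position by position) — the same honest caveat as every residual exemplar of this
  programme (g19 `hcStrat`, g20).  Row-padding test: `StabCounter` is SATURATED under the gauge (`stabCounter_of_
  stabCounter_pad`, `stabCounter_pad_of_stabCounter`), so B is not `≡ D` by re-padding.  Idea needed: a loss law for
  deviation gates with an `AND` bottom layer (even fan-in 2) — the CDH side; or a dark-window law "in expectation"
  (a window dark for MOST inputs).
* `closes : CounterLoss3 → NonCounterGenericLoss3 → DenseGenericLoss3` (BY NAME; `by_cases StabCounter (c+1) P`, `a, C,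
  n₀ := max`, tree `stabFew_mono_mr` / `one_le_logpow` / `loss_shape_mono`); `dense_iff_split`.  ONE layer, no EQUIV
  layer, no costume piece: both pieces UNDECIDED and strictly weaker (as implications from proved facts) than D.

## Why novel (one sentence)
No node on the bus and no tree decl cuts D (or any QA residual) by the ALGEBRAIC FORM OF THE DEVIATION GATES — level
sets of `Z₃`-linear forms versus gates needing an `AND` layer —, the cut that puts every named dense family on one side
and aligns the residual with the printed two-moduli / constant-degree boundary; and the dark-window law (three adjacent
flips, type-quantified core) is a new member of the lineage's orbit-law family that removes g14's one-gap hypothesis.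

## Barriers (catalogue `Literature/Barriers/QuantumAdvantage/`)
technique_class: combinatorial orbit laws + two-moduli exponential sums on an explicit search game.  Relativization /
Algebrization / NaturalProofs / AaronsonChen*: do not quantify over this typed game statement (no oracle, no circuit
class lower bound is asserted by A or B as typed).  `TwoModuliDepthTwo`: A sits INSIDE its solved `d = 1` device class
(as a resource, not an obstruction); B sits in the open `d ≥ 2` regime — recorded above as B's barrier-adjacency, not
evaded.  `NonclassicalDegreeLogBarrier` (Bhowmick–Lovett): bites derivative/Gowers-norm proofs of `MOD₃`-correlation for
degree `≥ log n` polynomials — relevant to B (polylog-degree selectors), not to the dark-window law (degree-free) nor to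
A's linear-bottom sums.

## Dropped cuts (this generation's dead ends, one line each; details in the seat's NOTES.md)
DarkDial-as-node (special = dark somewhere: a LAW, residual ≡ D, zero score — kept as engine) · window-flip laws for
counter-RESPONSIVE fields (𝔽₂ span contains the all-ones vector for every sign pattern at L = 4, 5, 6: no universal
law; FullPaley needs character sums) · 2-site dark windows (all-win orbits exist) · phase / cluster / junta / checkerboard /
majority dials (costume, or stronger than D, or ≡ earlier lenses).
-/

set_option linter.dupNamespace false
noncomputable section
open scoped Classical

namespace Summit.QuantumAdvantage.QuantumAdvantage.Theorems.CounterDial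
open Finset
open Literature.Computability.QuantumComplexity Literature.Computability.QuantumComplexity.RingHLF
open Literature.Computability.MetaComplexity Literature.Computability.MetaComplexity.Smolensky
open Summit.QuantumAdvantage.AdviceFreeQNC0
open Summit.QuantumAdvantage.QuantumAdvantage.Theorems.AnchorDial (outB dev cN fz fz_apply orbL orbL_cons orbL_nil
  oddZeros_orbL zpar_orbL orbL_apply_of_far cN_orbL orbL_invol card_filter_orbL sh sgN win_iff gCond_iff_cN
  orbF oddZeros_orbF orbF_apply_of_far card_filter_orbF three_counts card_odd_ge loss_shape_mono)
open Summit.QuantumAdvantage.QuantumAdvantage.Theorems.HolonomyDial (gCond tPoly tPoly_apply tPoly_mem xorP xorP_mem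
  xorP_apply_bool indP indP_apply mono_singleton_apply)
open Summit.QuantumAdvantage.QuantumAdvantage.Theorems.StabilizerDial (apIdx apStrat apStrat_mem bitP bitP_apStrat pad
  pad_mem rel_pad_iff StabFew outB_pad_pad outB_pad_congr bitP_gsum gsum gsum_mem deg_gsum dev_congr)
open Summit.QuantumAdvantage.QuantumAdvantage.Theorems.SparsityDial (real_loss_of_frac stabFew_mono_mr one_le_logpow)
open Summit.QuantumAdvantage.QuantumAdvantage.Theorems.ResponseDial (loddG loddG_mem wStrat wStrat_agree wStrat_mem
  WindowCounterLoss3 windowCounterLoss3_of_dense wStrat_in_dense_class mem_dev_apStrat dev_pad_zero)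
open Summit.QuantumAdvantage.QuantumAdvantage.Theses.SparsityDial (DenseGenericLoss3)
open Summit.QuantumAdvantage.QuantumAdvantage.Theorems.BlindDial (loddG_apply loddG_congr mem_dev_wStrat_second
  mem_dev_wStrat_first apIdx_val_first fullPaleyW FullPaleyCounterLoss3)

variable {N : ℕ}

/-! ## §1  The dark window: three ADJACENT pair-flip sites `b, b+1, b+2` (cells `b … b+3`) -/

/-- the three flip sites of the window at `b`. -/
def wsite (b : ℕ) (i : Fin 3) : ℕ := b + i.val

/-- the orbit point `x^ε`: for each `i < 3` with `ε i`, flip the adjacent pair of cells `{b+i, b+i+1}`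
(eight points; the flips overlap — this is NOT a product of far flips). -/
def dw (b : ℕ) (ε : Fin 3 → Bool) (x : Fin N → Bool) : Fin N → Bool := orbF (wsite b) ε x

/-- the dark-window orbit stays inside the odd class. -/
theorem oddZeros_dw {b : ℕ} (hb : b + 5 ≤ N) (ε : Fin 3 → Bool) (x : Fin N → Bool) :
    OddZeros (dw b ε x) ↔ OddZeros x :=
  oddZeros_orbF (fun i => by have := i.isLt; simp only [wsite]; omega) ε x

/-- cells outside `b … b+3` are not moved by the dark-window orbit. -/
theorem dw_apply_of_far (b : ℕ) (ε : Fin 3 → Bool) (x : Fin N → Bool) (j : Fin N)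
    (hj : j.val < b ∨ b + 3 < j.val) : dw b ε x j = x j :=
  orbF_apply_of_far _ ε x j fun i => by have := i.isLt; simp only [wsite]; omega

/-- the parity signature of `x` seen by the window: `z i = zpar x (b+i+1)`. -/
def zsig (b : ℕ) (x : Fin N → Bool) (i : Fin 3) : Bool := zpar x (b + i.val + 1)

/-- the kernel-phase shift at BAND `β ∈ {0,1,2,3}` (`β = min (k-b) 3` for position `k`): the sites `i` with
`i + 1 ≤ β` lie below `k`. -/
def shW (ε z : Fin 3 → Bool) (β : ℕ) : ℕ := ∑ i : Fin 3, sh (ε i) (decide (i.val + 1 ≤ β)) (z i)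

/-- **kernel phases along the dark-window orbit**: `c_k(x^ε) ≡ c_k(x) + shW ε z (min (k-b) 3)  (mod 3)`. -/
theorem cN_dw {b : ℕ} (hb : b + 5 ≤ N) (ε : Fin 3 → Bool) (x : Fin N → Bool) (k : ℕ) (hk : k ≤ N) :
    cN (dw b ε x) k % 3 = (cN x k + shW ε (zsig b x) (min (k - b) 3)) % 3 := by
  have hl : ∀ p ∈ List.ofFn (fun i : Fin 3 => (ε i, wsite b i)), p.2 + 3 ≤ N :=
    List.forall_mem_ofFn_iff.2 fun i => by have := i.isLt; simp only [wsite]; omega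
  have hpw : (List.ofFn fun i : Fin 3 => (ε i, wsite b i)).Pairwise (fun p q => p.2 ≠ q.2) :=
    List.pairwise_ofFn.2 fun i j hij => by
      have := Fin.lt_def.1 hij; simp only [wsite]; omega
  have h := cN_orbL x k hk _ hl hpw
  unfold dw orbF
  rw [h, List.map_ofFn, List.sum_ofFn]
  congr 2
  unfold shW
  refine sum_congr rfl fun i _ => ?_
  have hi := i.isLt
  simp only [Function.comp_apply, wsite, zsig]
  congr 1
  · by_cases h1 : b + i.val + 1 ≤ k
    · rw [decide_eq_true h1, decide_eq_true (by omega)]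
    · rw [decide_eq_false h1, decide_eq_false (by omega)]

/-! ## §2  The abstract core: band types and the eight shifts -/

/-- the BAND TYPE code: the parities `(f β 0, f β 1, f β 2) % 2` of a band's three shifted kernel counts have even
weight (§3), hence are one of `000, 011, 101, 110`, coded by two booleans. -/
def tfB (hi lo : Bool) (r : ℕ) : ℕ :=
  if hi = true ∧ lo = true then 0
  else if hi = false ∧ lo = false then (if r % 3 = 0 then 0 else 1)
  else if hi = false ∧ lo = true then (if r % 3 = 1 then 0 else 1)
  else (if r % 3 = 2 then 0 else 1)

/-- `tfB` depends on the shift only modulo `3`. -/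
theorem tfB_mod (hi lo : Bool) (r : ℕ) : tfB hi lo r = tfB hi lo (r % 3) := by
  simp only [tfB, Nat.mod_mod]

/-- the parity vector of the three shifted kernel counts of a band is an even-weight TYPE (explicit witnesses). -/
theorem type_lemma : ∀ a, a < 2 → ∀ b, b < 2 → ∀ c, c < 2 → (a + b + c) % 2 = 0 →
    a = tfB (decide (c = 0)) (decide (b = 0)) 0 ∧ b = tfB (decide (c = 0)) (decide (b = 0)) 1 ∧
      c = tfB (decide (c = 0)) (decide (b = 0)) 2 := by
  intro a ha b hb c hc h
  interval_cases a <;> interval_cases b <;> interval_cases c <;>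
    first | decide | exact absurd h (by decide)

/-- **the core** (a finite check, `2048 × 8` cases): whatever the three parity bits and the four band types, one of the
eight orbit points has an EVEN total. -/
theorem core : ∀ z₀ z₁ z₂ h₀ l₀ h₁ l₁ h₂ l₂ h₃ l₃ : Bool, ∃ e₀ e₁ e₂ : Bool,
    (tfB h₀ l₀ (shW ![e₀, e₁, e₂] ![z₀, z₁, z₂] 0) + tfB h₁ l₁ (shW ![e₀, e₁, e₂] ![z₀, z₁, z₂] 1) +
      tfB h₂ l₂ (shW ![e₀, e₁, e₂] ![z₀, z₁, z₂] 2) + tfB h₃ l₃ (shW ![e₀, e₁, e₂] ![z₀, z₁, z₂] 3)) % 2 = 0 := by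
  decide

/-! ## §3  THE DARK-WINDOW LAW -/

/-- **THE DARK-WINDOW LAW (pointwise).**  If the deviation set of a strategy is the same at the eight points of the
dark-window orbit of an odd input `x` (the window `b … b+3` is DARK for the strategy at `x`), the strategy LOSES at one
of the eight points.  No gap hypothesis, no degree hypothesis, no certificate: three adjacent sites suffice where two
far sites need the deviation set to sit in one gap (`AnchorDial.frozen_orbit_loses`). -/
theorem dark_orbit_loses (hN : 3 ≤ N) {b : ℕ} (hb : b + 5 ≤ N) (P : Fin N → CubeFn (ZMod 3) N)
    (x : Fin N → Bool) (hx : OddZeros x) (hdark : ∀ ε : Fin 3 → Bool, dev P (dw b ε x) = dev P x) :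
    ∃ ε : Fin 3 → Bool, ¬ Rel (dw b ε x) (outB P (dw b ε x)) := by
  by_contra hall
  simp only [not_exists, not_not] at hall
  set w := dev P x with hw
  set z : Fin 3 → Bool := zsig b x with hz
  -- the band pieces of the deviation set and their shifted kernel counts
  set T : ℕ → Finset (Fin N) := fun β => w.filter fun k => min (k.val - b) 3 = β with hT
  set f : ℕ → ℕ → ℕ := fun β r => ((T β).filter fun k => (cN x k.val + r) % 3 ≠ 2).card with hf
  have hper : ∀ β r, f β r = f β (r % 3) := by
    intro β r
    simp only [hf]
    congr 1
    refine filter_congr fun k _ => ?_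
    constructor <;> intro h <;> omega
  have hsum : ∀ β, f β 0 + f β 1 + f β 2 = 2 * (T β).card := fun β =>
    three_counts (T β) fun k => cN x k.val
  -- every band has a type
  have htyp : ∀ β, ∃ hi lo : Bool, ∀ r, f β r % 2 = tfB hi lo r := by
    intro β
    obtain ⟨h0, h1, h2⟩ := type_lemma (f β 0 % 2) (Nat.mod_lt _ two_pos) (f β 1 % 2)
      (Nat.mod_lt _ two_pos) (f β 2 % 2) (Nat.mod_lt _ two_pos) (by have := hsum β; omega)
    refine ⟨decide (f β 2 % 2 = 0), decide (f β 1 % 2 = 0), fun r => ?_⟩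
    rw [hper β r, tfB_mod _ _ r]
    rcases (by omega : r % 3 = 0 ∨ r % 3 = 1 ∨ r % 3 = 2) with h | h | h <;> rw [h] <;> assumption
  choose hi lo hcode using htyp
  -- all eight orbit points win: band by band this is an odd total of type values
  have hwin : ∀ ε : Fin 3 → Bool,
      (tfB (hi 0) (lo 0) (shW ε z 0) + tfB (hi 1) (lo 1) (shW ε z 1) + tfB (hi 2) (lo 2) (shW ε z 2) +
        tfB (hi 3) (lo 3) (shW ε z 3)) % 2 = 1 := by
    intro ε
    have ho : OddZeros (dw b ε x) := (oddZeros_dw hb ε x).2 hx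
    have h1 := (win_iff hN P _ ho).1 (hall ε)
    rw [hdark ε] at h1
    have e : (w.filter fun k => gCond (dw b ε x) k.val) =
        w.filter fun k => (cN x k.val + shW ε z (min (k.val - b) 3)) % 3 ≠ 2 :=
      filter_congr fun k _ => by rw [gCond_iff_cN, cN_dw hb ε x k.val (le_of_lt k.isLt)]
    rw [e] at h1
    have hsplit : (w.filter fun k => (cN x k.val + shW ε z (min (k.val - b) 3)) % 3 ≠ 2).card =
        ∑ β ∈ range 4, f β (shW ε z β) := by
      rw [card_eq_sum_card_fiberwise (f := fun k : Fin N => min (k.val - b) 3) (t := range 4)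
        (fun k _ => mem_range.2 (by show min (k.val - b) 3 < 4; omega))]
      refine sum_congr rfl fun β _ => ?_
      simp only [hf, hT, filter_filter]
      congr 1
      ext k
      simp only [mem_filter]
      constructor
      · rintro ⟨hk, hc, hβ⟩
        exact ⟨hk, hβ, by rw [← hβ]; exact hc⟩
      · rintro ⟨hk, hβ, hc⟩
        exact ⟨hk, by rw [hβ]; exact hc, hβ⟩
    rw [hsplit, sum_range_succ, sum_range_succ, sum_range_succ, sum_range_one] at h1
    have c0 := hcode 0 (shW ε z 0)
    have c1 := hcode 1 (shW ε z 1)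
    have c2 := hcode 2 (shW ε z 2)
    have c3 := hcode 3 (shW ε z 3)
    omega
  -- the core says one orbit point has an even total
  obtain ⟨e₀, e₁, e₂, hcore⟩ :=
    core (z 0) (z 1) (z 2) (hi 0) (lo 0) (hi 1) (lo 1) (hi 2) (lo 2) (hi 3) (lo 3)
  have hz3 : (![z 0, z 1, z 2] : Fin 3 → Bool) = z := by
    ext i; fin_cases i <;> rfl
  rw [hz3] at hcore
  have := hwin ![e₀, e₁, e₂]
  omega

/-- the window `b … b+3` is DARK for `P` at `x`: the deviation set is constant on the dark-window orbit. -/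
def Dark (b : ℕ) (P : Fin N → CubeFn (ZMod 3) N) (x : Fin N → Bool) : Prop :=
  ∀ ε : Fin 3 → Bool, dev P (dw b ε x) = dev P x

/-- eightfold union bound along the orbit. -/
theorem card_exists_dw_le (b : ℕ) (Q : (Fin N → Bool) → Prop) [DecidablePred Q] :
    (univ.filter fun x : Fin N → Bool => ∃ ε : Fin 3 → Bool, Q (dw b ε x)).card
      ≤ 8 * (univ.filter fun x => Q x).card := by
  calc (univ.filter fun x : Fin N → Bool => ∃ ε : Fin 3 → Bool, Q (dw b ε x)).card
      ≤ (univ.biUnion fun ε : Fin 3 → Bool => univ.filter fun x : Fin N → Bool => Q (dw b ε x)).card := by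
        refine card_le_card fun x hx => ?_
        rw [mem_filter] at hx
        obtain ⟨ε, hε⟩ := hx.2
        rw [mem_biUnion]
        exact ⟨ε, mem_univ _, mem_filter.2 ⟨mem_univ _, hε⟩⟩
    _ ≤ ∑ ε : Fin 3 → Bool, (univ.filter fun x : Fin N → Bool => Q (dw b ε x)).card := card_biUnion_le
    _ = ∑ ε : Fin 3 → Bool, (univ.filter fun x => Q x).card := by
        refine sum_congr rfl fun ε _ => ?_
        exact card_filter_orbF Q (wsite b) ε
    _ = 8 * (univ.filter fun x => Q x).card := by
        rw [sum_const, card_univ, smul_eq_mul]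
        norm_num [Fintype.card_fun, Fintype.card_bool, Fintype.card_fin]

/-- **THE DARK-WINDOW LAW (counting)**: `#{odd x : the window is dark at x} ≤ 8 · #{odd losers}`. -/
theorem dark_loss_count (hN : 3 ≤ N) {b : ℕ} (hb : b + 5 ≤ N) (P : Fin N → CubeFn (ZMod 3) N) :
    (univ.filter fun x : Fin N → Bool => OddZeros x ∧ Dark b P x).card ≤
      8 * (univ.filter fun x : Fin N → Bool => OddZeros x ∧ ¬ Rel x (outB P x)).card := by
  refine le_trans (card_le_card fun x hx => ?_)
    (card_exists_dw_le b (fun y : Fin N → Bool => OddZeros y ∧ ¬ Rel y (outB P y)))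
  rw [mem_filter] at hx ⊢
  obtain ⟨-, hodd, hD⟩ := hx
  obtain ⟨ε, hε⟩ := dark_orbit_loses hN hb P x hodd hD
  exact ⟨mem_univ _, ε, (oddZeros_dw hb ε x).2 hodd, hε⟩

/-! ## §4  Application: every GAPPED window-counter family loses (a decided sub-rung of the special piece) -/

/-- the window system `W` has a GAP at `b`: the four cells `b … b+3` lie in the first half-cycle (so no antipodal
pointer reads them) and in no counter's window. -/
def GapAt (N b : ℕ) (W : Fin N → Finset (Fin N)) : Prop :=
  b + 5 ≤ N ∧ b + 4 ≤ N / 2 ∧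
    ∀ k : Fin N, ¬ (1 ≤ k.val ∧ k.val < N / 2) → ∀ i ∈ W k, i.val < b ∨ b + 3 < i.val

/-- a gap is a dark window of the window-counter strategy, at EVERY input. -/
theorem wStrat_dark {b : ℕ} {W : Fin N → Finset (Fin N)} (hg : GapAt N b W) (x : Fin N → Bool) :
    Dark b (fun i : Fin N => wStrat W i) x := by
  intro ε
  ext k
  by_cases hk : 1 ≤ k.val ∧ k.val < N / 2
  · rw [mem_dev_wStrat_first W _ k hk, mem_dev_wStrat_first W _ k hk, dw_apply_of_far]
    have := apIdx_val_first k hk.2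
    have := hg.2.1
    omega
  · rw [mem_dev_wStrat_second W _ k hk, mem_dev_wStrat_second W _ k hk,
      loddG_congr W k (fun i hi => dw_apply_of_far b ε x i (hg.2.2 k hk i hi))]

/-- **decided sub-rung**: a gapped window-counter family loses at least an eighth of the odd class. -/
theorem gapped_loss (hN : 3 ≤ N) {b : ℕ} {W : Fin N → Finset (Fin N)} (hg : GapAt N b W) :
    (univ.filter fun x : Fin N → Bool => OddZeros x).card ≤
      8 * (univ.filter fun x : Fin N → Bool =>
        OddZeros x ∧ ¬ Rel x (outB (fun i : Fin N => wStrat W i) x)).card := by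
  refine le_trans (le_of_eq (congrArg card (filter_congr fun x _ => ?_))) (dark_loss_count hN hg.1 _)
  exact (and_iff_left (wStrat_dark hg x)).symm

/-- **every eventually-gapped window system is DECIDED**: `WindowCounterLoss3 W`. -/
theorem gappedCounterLoss3 (W : (n : ℕ) → Fin n → Finset (Fin n))
    (hW : ∃ n₁, ∀ n ≥ n₁, ∃ b, GapAt n b (W n)) : WindowCounterLoss3 W := by
  obtain ⟨n₁, hn₁⟩ := hW
  refine ⟨1, max n₁ 8, fun n hn => ?_⟩
  obtain ⟨b, hg⟩ := hn₁ n (le_trans (le_max_left _ _) hn)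
  have h8 : 8 ≤ n := le_trans (le_max_right _ _) hn
  exact real_loss_of_frac (M := 8) (by norm_num) h8 (by omega) _ (gapped_loss (by omega) hg)

/-- PUNCHING a window system: remove the four cells `8 … 11` from every window. -/
def punch (W : (n : ℕ) → Fin n → Finset (Fin n)) (n : ℕ) (k : Fin n) : Finset (Fin n) :=
  (W n k).filter fun i => i.val < 8 ∨ 11 < i.val

/-- **every window system is four cells away from a decided one.** -/
theorem punchedCounterLoss3 (W : (n : ℕ) → Fin n → Finset (Fin n)) : WindowCounterLoss3 (punch W) :=
  gappedCounterLoss3 (punch W) ⟨24, fun n hn => ⟨8, by omega, by omega, fun k _ i hi => (mem_filter.1 hi).2⟩⟩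

end Summit.QuantumAdvantage.QuantumAdvantage.Theorems.CounterDial
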